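import Summits.HodgeConjecture.HodgeConjecture.Theorems.Ring2AtlasWeilCarriersEE
import Summits.HodgeConjecture.HodgeConjecture.Theorems.Ring2AbelianAllCurveTimesThreefold
import HarnessLib

/-!
# Ring 2 · atlas-2 (generation 11), part 2 — the carrier tenfolds `Y₄ × Z₃²`: the FOURFOLD slice discharged by
Floccari–Fu (refereed), the SIXFOLD slice restricted to the split sixfolds `Y₄ × E₀²`

HONEST FRAMING: research route conditional on HC_CM; not a corollary; Q11.4-sentence-2 already refuted in dim ≥ 3.

Cell `pub-hodge-ring2`, seat `pub-hodge-ring2-atlas-2` (generation 11). Sequel of `Ring2AtlasWeilCarriersEE` (p205760):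
there, `HC(T)` for a Weil-type `(5,5)` tenfold `T = Y × Z × Z` (`dim Y = 4`, `dim Z = 3`, `K = ℚ(√-d)` diagonal) with
divisor-and-Weil-generated Hodge ring was reduced, through the balanced elliptic completions
`F_Y = Y × E₀ × E₀` (type `(3,3)`) and `F_Z = Z × E₀` (type `(2,2)`) and the motivic seat's elliptic exchange, to
the algebraicity of Weil classes on ALL Weil-type sixfolds and fourfolds for `ℚ(√-d)`. This part sharpens the two
slice inputs to what the proof actually consumes and discharges one of them from a REFEREED named fact:

* §1 `hodgeConjectureFor_prod_prod_of_weilGenerated_of_completionSlices`: the slice hypotheses restricted to the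
  completions themselves — Weil classes algebraic on the Weil-type sixfolds `Y × E₀ × E₀` (`E₀` a CM curve,
  structure `ψ × ψ₀ × ψ₀`) and on the Weil-type fourfolds `Z × E₀` (structure `χ × ψ₀`).
* §2 `weilAlgebraicFor_two_threefold_prod_curve_of_floccariFu`: the FOURFOLD completion slice is a THEOREM modulo
  the refereed named fact `FloccariFu2026_hodgeClasses_algebraic_powers_discOneWeilFourfold` (Floccari–Fu 2026,
  JMPA 210, Thm. 1.2: all Hodge classes on all powers of a discriminant-1 Weil fourfold are algebraic) ALONE — by the
  AbelianAll seat's tree theorem `Ring2.AbelianAll.hasDiscOneWeilStructure_threefold_prod_curve` (p205560: a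
  Weil-type `(2,2)` product `threefold × curve` carries a discriminant-1 Weil structure — weighted Segre polarisation +
  Landherr, no named fact) and `hodgeConjectureFor_powSucc_threefold_prod_curve_of_floccariFu` (power `N = 0`).
* §3 CELL ROWS: both carrier cells (`HodgeQuarticFieldFourfoldCMThreefoldSquaredCarrier`,
  `HodgeQuadraticFourfold31CMThreefoldSquaredCarrier`) from the typed cell hypothesis `(S+G)_T` of part 1 (CELL
  INFERENCE, engine-certified, entered as an argument, never asserted), the Floccari–Fu fact, and ONE remaining
  input: Weil classes algebraic on the Weil-type SPLIT SIXFOLDS `Y' × E₀ × E₀` (`dim Y' = 4`, `E₀` a CM curve, any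
  `d`) — the exact shape served (i) by the route item `W₆` (stmt-HodgeConjecture-2524) by name, row `…_of_weilSixfolds_…`,
  (ii) in print by Markman arXiv:2502.03415 Thm. 1.5.1 (UNREFEREED; needs the hyperbolicity of `Y' × E₀²`, which the
  same Segre-weight argument gives — NOT a kernel theorem at level 3 yet: the AbelianAll seat announced the
  `fivefold × curve` Segre partner lemma for a later generation), (iii) REFEREED for `K = ℚ(i)` (Koike 2004) and
  `K = ℚ(√-3)` (Schoen 1998) on hyperbolic sixfolds. KIND of `HC_CM` on every row: ABSENT.

Sources: [cite: FloccariFu2026, Theorem 1.2] [cite: Schoen1998HodgeWeilAddendum, §10] [cite: Deligne1982HodgeCycles, §5 (c)]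
[cite: MoonenZarhin1999LowDim, Thm. 0.1 (a), §2 (2.5)(2)] [cite: vanGeemen1994HodgeAV, Lemma 5.2, 5.4, Thm. 6.12]
[cite: Markman2025SecantWeil, Thm. 1.5.1] [cite: Koike2004WeilHodge, Thm. 2.1] [cite: Landherr1936HermitianForms]
-/

open CategoryTheory

namespace Summit.HodgeConjecture.HodgeConjecture.Ring2.Atlas

open Literature.AlgebraicGeometry Literature.AlgebraicGeometry.Motives
open Literature.AlgebraicGeometry.HodgeTheory
open Literature.AlgebraicTopology.SingularHomology
open Literature.Barriers.HodgeConjecture (divisorClassesSpan)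
open Summit.HodgeConjecture.HodgeConjecture.Theses
open Summit.HodgeConjecture.HodgeConjecture.Ring2.Hypotheses
open Summit.HodgeConjecture.HodgeConjecture.Ring2.AbelianAll
open Summit.HodgeConjecture.HodgeConjecture.Theorems.HodgeAbelianVarieties.Unconditional
open Summit.HodgeConjecture.HodgeConjecture.Cruxes.HodgeAbelianVarieties.EStepSecantInduction
  (WeilAlgebraicFor WeilAlgebraicAll)

section Carrier

variable {Y Z : AbelianVariety ℂ} {d : ℕ} {ψ : Y ⟶ Y} {χ : Z ⟶ Z}

/-! ## §1 The reduction with completion-restricted slices (unconditional) -/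

/-- **HC for the tenfold `T = Y × Z × Z` from generation + the two COMPLETION slices.** As
`hodgeConjectureFor_prod_prod_of_weilGenerated_of_slices` (part 1), but the Weil inputs are asked only on the
completions: on every Weil-type `(3,3)` sixfold `Y × E₀ × E₀` with structure `ψ × ψ₀ × ψ₀` (`E₀` a curve,
`ψ₀ ≫ ψ₀ = -d`) and on every Weil-type `(2,2)` fourfold `Z × E₀` with structure `χ × ψ₀`.
[cite: Schoen1998HodgeWeilAddendum, §10 (Proposition and proof)] [cite: Deligne1982HodgeCycles, §5 (c)]
[cite: vanGeemen1994HodgeAV, §2.4 and Thm. 6.12] -/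
theorem hodgeConjectureFor_prod_prod_of_weilGenerated_of_completionSlices (hd : 0 < d) (hY : Y.dim = 4)
    (hZ : Z.dim = 3) (hψ : ψ ≫ ψ = -(d • 𝟙 Y)) (hχ : χ ≫ χ = -(d • 𝟙 Z))
    (hT : IsWeilType (Y.prod (Z.prod Z))
      (AbelianVariety.prodLift (AbelianVariety.fst Y (Z.prod Z) ≫ ψ)
        (AbelianVariety.snd Y (Z.prod Z) ≫
          AbelianVariety.prodLift (AbelianVariety.fst Z Z ≫ χ) (AbelianVariety.snd Z Z ≫ χ))) 5 d)
    (hG : IsDivisorWeilGenerated (Y.prod (Z.prod Z))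
      (AbelianVariety.prodLift (AbelianVariety.fst Y (Z.prod Z) ≫ ψ)
        (AbelianVariety.snd Y (Z.prod Z) ≫
          AbelianVariety.prodLift (AbelianVariety.fst Z Z ≫ χ) (AbelianVariety.snd Z Z ≫ χ))) 5 d)
    (h₃ : ∀ (E₀ : AbelianVariety ℂ) (ψ₀ : E₀ ⟶ E₀), E₀.dim = 1 → ψ₀ ≫ ψ₀ = -(d • 𝟙 E₀) →
      IsWeilType (Y.prod (E₀.prod E₀))
        (AbelianVariety.prodLift (AbelianVariety.fst Y (E₀.prod E₀) ≫ ψ)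
          (AbelianVariety.snd Y (E₀.prod E₀) ≫
            AbelianVariety.prodLift (AbelianVariety.fst E₀ E₀ ≫ ψ₀) (AbelianVariety.snd E₀ E₀ ≫ ψ₀))) 3 d →
      WeilAlgebraicFor 3 d (Y.prod (E₀.prod E₀))
        (AbelianVariety.prodLift (AbelianVariety.fst Y (E₀.prod E₀) ≫ ψ)
          (AbelianVariety.snd Y (E₀.prod E₀) ≫
            AbelianVariety.prodLift (AbelianVariety.fst E₀ E₀ ≫ ψ₀) (AbelianVariety.snd E₀ E₀ ≫ ψ₀))))
    (h₂ : ∀ (E₀ : AbelianVariety ℂ) (ψ₀ : E₀ ⟶ E₀), E₀.dim = 1 → ψ₀ ≫ ψ₀ = -(d • 𝟙 E₀) →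
      IsWeilType (Z.prod E₀)
        (AbelianVariety.prodLift (AbelianVariety.fst Z E₀ ≫ χ) (AbelianVariety.snd Z E₀ ≫ ψ₀)) 2 d →
      WeilAlgebraicFor 2 d (Z.prod E₀)
        (AbelianVariety.prodLift (AbelianVariety.fst Z E₀ ≫ χ) (AbelianVariety.snd Z E₀ ≫ ψ₀))) :
    HodgeConjectureFor (Y.prod (Z.prod Z)).dim (Y.prod (Z.prod Z)).X := by
  obtain ⟨E₀, ψ₀, hE, hψ₀, hFZ, hFY⟩ := exists_balanced_ellipticCompletions hd hY hZ hψ hχ hT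
  have hnψ₀ : (-ψ₀) ≫ (-ψ₀) = -(d • 𝟙 E₀) := by
    rw [Preadditive.neg_comp, Preadditive.comp_neg, neg_neg, hψ₀]
  exact hodgeConjectureFor_of_isDivisorWeilGenerated hT hG
    (fun p ↦ divisorClassesSpan_le_algebraicClasses_holds _ p)
    (fun c hcW hc hH ↦ weilClasses_ellipticExchange_four_three_three hd hY hZ hE hψ hχ hψ₀
      (hFY.weilClassesOf_le_algebraicClasses (h₃ E₀ (-ψ₀) hE hnψ₀ hFY))
      (hFZ.weilClassesOf_le_algebraicClasses (h₂ E₀ ψ₀ hE hψ₀ hFZ)) c hc hH hcW)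

/-! ## §2 The fourfold completion slice from Floccari–Fu (refereed named fact) -/

/-- **Weil classes on the Weil-type `(2,2)` fourfolds `Z × E₀` (`Z` a threefold, `E₀` a curve) are algebraic, modulo
Floccari–Fu 2026 Thm. 1.2 ALONE**: the AbelianAll seat's `hasDiscOneWeilStructure_threefold_prod_curve` (discriminant
`1` from a weighted Segre polarisation + Landherr; tree theorem) feeds the named fact, which gives `HC(Z × E₀)`
(`hodgeConjectureFor_powSucc_threefold_prod_curve_of_floccariFu`, power `N = 0`), whence the Weil plane is algebraic
(`weilClasses_algebraic_of_hodgeConjectureFor`). [cite: FloccariFu2026, Theorem 1.2]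
[cite: MoonenZarhin1999LowDim, Thm. 0.1 (a)] [cite: vanGeemen1994HodgeAV, Lemma 5.2 (2)–(4) and 5.4] -/
theorem weilAlgebraicFor_two_threefold_prod_curve_of_floccariFu
    (h5 : FloccariFu2026_hodgeClasses_algebraic_powers_discOneWeilFourfold) (hZ : Z.dim = 3)
    {E₀ : AbelianVariety ℂ} {ψ₀ : E₀ ⟶ E₀} (hE : E₀.dim = 1) (hd : 0 < d) (hχ : χ ≫ χ = -(d • 𝟙 Z))
    (hψ₀ : ψ₀ ≫ ψ₀ = -(d • 𝟙 E₀))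
    (hW : IsWeilType (Z.prod E₀)
      (AbelianVariety.prodLift (AbelianVariety.fst Z E₀ ≫ χ) (AbelianVariety.snd Z E₀ ≫ ψ₀)) 2 d) :
    WeilAlgebraicFor 2 d (Z.prod E₀)
      (AbelianVariety.prodLift (AbelianVariety.fst Z E₀ ≫ χ) (AbelianVariety.snd Z E₀ ≫ ψ₀)) :=
  weilClasses_algebraic_of_hodgeConjectureFor hW
    (hodgeConjectureFor_powSucc_threefold_prod_curve_of_floccariFu h5 hZ hE hd hχ hψ₀ hW 0)

/-- **HC for the tenfold `T = Y × Z × Z` from generation, the SPLIT-SIXFOLD slice and Floccari–Fu.**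
[cite: FloccariFu2026, Theorem 1.2] [cite: Schoen1998HodgeWeilAddendum, §10] [cite: Deligne1982HodgeCycles, §5 (c)] -/
theorem hodgeConjectureFor_prod_prod_of_weilGenerated_of_splitSixfolds_of_floccariFu
    (h5 : FloccariFu2026_hodgeClasses_algebraic_powers_discOneWeilFourfold) (hd : 0 < d) (hY : Y.dim = 4)
    (hZ : Z.dim = 3) (hψ : ψ ≫ ψ = -(d • 𝟙 Y)) (hχ : χ ≫ χ = -(d • 𝟙 Z))
    (hT : IsWeilType (Y.prod (Z.prod Z))
      (AbelianVariety.prodLift (AbelianVariety.fst Y (Z.prod Z) ≫ ψ)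
        (AbelianVariety.snd Y (Z.prod Z) ≫
          AbelianVariety.prodLift (AbelianVariety.fst Z Z ≫ χ) (AbelianVariety.snd Z Z ≫ χ))) 5 d)
    (hG : IsDivisorWeilGenerated (Y.prod (Z.prod Z))
      (AbelianVariety.prodLift (AbelianVariety.fst Y (Z.prod Z) ≫ ψ)
        (AbelianVariety.snd Y (Z.prod Z) ≫
          AbelianVariety.prodLift (AbelianVariety.fst Z Z ≫ χ) (AbelianVariety.snd Z Z ≫ χ))) 5 d)
    (h₃ : ∀ (E₀ : AbelianVariety ℂ) (ψ₀ : E₀ ⟶ E₀), E₀.dim = 1 → ψ₀ ≫ ψ₀ = -(d • 𝟙 E₀) →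
      IsWeilType (Y.prod (E₀.prod E₀))
        (AbelianVariety.prodLift (AbelianVariety.fst Y (E₀.prod E₀) ≫ ψ)
          (AbelianVariety.snd Y (E₀.prod E₀) ≫
            AbelianVariety.prodLift (AbelianVariety.fst E₀ E₀ ≫ ψ₀) (AbelianVariety.snd E₀ E₀ ≫ ψ₀))) 3 d →
      WeilAlgebraicFor 3 d (Y.prod (E₀.prod E₀))
        (AbelianVariety.prodLift (AbelianVariety.fst Y (E₀.prod E₀) ≫ ψ)
          (AbelianVariety.snd Y (E₀.prod E₀) ≫
            AbelianVariety.prodLift (AbelianVariety.fst E₀ E₀ ≫ ψ₀) (AbelianVariety.snd E₀ E₀ ≫ ψ₀)))) :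
    HodgeConjectureFor (Y.prod (Z.prod Z)).dim (Y.prod (Z.prod Z)).X :=
  hodgeConjectureFor_prod_prod_of_weilGenerated_of_completionSlices hd hY hZ hψ hχ hT hG h₃
    (fun _ _ hE hψ₀ hW ↦ weilAlgebraicFor_two_threefold_prod_curve_of_floccariFu h5 hZ hE hd hχ hψ₀ hW)

end Carrier

/-! ## §3 The carrier cells: one sixfold input left -/

/-- **CELL ROW — the `Y₄/M × Z₃²` carrier cell from `(S+G)_T` (CELL INFERENCE, hypothesis — part 1), the SPLIT-SIXFOLD
slice (Weil classes algebraic on every Weil-type `(3,3)` sixfold `Y' × E₀ × E₀`, `dim Y' = 4`, `E₀` a curve, any `d`)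
and Floccari–Fu 2026 Thm. 1.2 (refereed named fact).** KIND of `HC_CM`: ABSENT. No tenfold input, no general fourfold
input. [cite: FloccariFu2026, Theorem 1.2] [cite: MoonenZarhin1999LowDim, §2 (2.5)(2) and §5 Case 2]
[cite: Schoen1998HodgeWeilAddendum, §10] -/
theorem hodgeQuarticFieldFourfoldCMThreefoldSquaredCarrier_of_weilGenerated_of_splitSixfolds_of_floccariFu
    (hSG : ∀ (Y Z : AbelianVariety ℂ) (ψ : Y ⟶ Y) (χ : Z ⟶ Z) (d : ℕ), 0 < d → IsQuarticFieldTypeIVFourfold Y →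
      Z.dim = 3 → Z.IsSimple → IsField Z.endAlgebra → Module.finrank ℚ Z.endAlgebra = 6 →
      ψ ≫ ψ = -(d • 𝟙 Y) → χ ≫ χ = -(d • 𝟙 Z) →
      ∃ χ' : Z ⟶ Z, χ' ≫ χ' = -(d • 𝟙 Z) ∧
        IsWeilType (Y.prod (Z.prod Z))
          (AbelianVariety.prodLift (AbelianVariety.fst Y (Z.prod Z) ≫ ψ)
            (AbelianVariety.snd Y (Z.prod Z) ≫
              AbelianVariety.prodLift (AbelianVariety.fst Z Z ≫ χ') (AbelianVariety.snd Z Z ≫ χ'))) 5 d ∧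
        IsDivisorWeilGenerated (Y.prod (Z.prod Z))
          (AbelianVariety.prodLift (AbelianVariety.fst Y (Z.prod Z) ≫ ψ)
            (AbelianVariety.snd Y (Z.prod Z) ≫
              AbelianVariety.prodLift (AbelianVariety.fst Z Z ≫ χ') (AbelianVariety.snd Z Z ≫ χ'))) 5 d)
    (h₃ : ∀ (d : ℕ) (Y' E₀ : AbelianVariety ℂ) (ψ' : Y' ⟶ Y') (ψ₀ : E₀ ⟶ E₀), Y'.dim = 4 → E₀.dim = 1 →
      ψ' ≫ ψ' = -(d • 𝟙 Y') → ψ₀ ≫ ψ₀ = -(d • 𝟙 E₀) →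
      IsWeilType (Y'.prod (E₀.prod E₀))
        (AbelianVariety.prodLift (AbelianVariety.fst Y' (E₀.prod E₀) ≫ ψ')
          (AbelianVariety.snd Y' (E₀.prod E₀) ≫
            AbelianVariety.prodLift (AbelianVariety.fst E₀ E₀ ≫ ψ₀) (AbelianVariety.snd E₀ E₀ ≫ ψ₀))) 3 d →
      WeilAlgebraicFor 3 d (Y'.prod (E₀.prod E₀))
        (AbelianVariety.prodLift (AbelianVariety.fst Y' (E₀.prod E₀) ≫ ψ')
          (AbelianVariety.snd Y' (E₀.prod E₀) ≫
            AbelianVariety.prodLift (AbelianVariety.fst E₀ E₀ ≫ ψ₀) (AbelianVariety.snd E₀ E₀ ≫ ψ₀))))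
    (h5 : FloccariFu2026_hodgeClasses_algebraic_powers_discOneWeilFourfold) :
    HodgeQuarticFieldFourfoldCMThreefoldSquaredCarrier := by
  intro Y Z ψ χ d hd hY hZ hZs hZf hZ6 hψ hχ
  obtain ⟨χ', hχ', hT, hG⟩ := hSG Y Z ψ χ d hd hY hZ hZs hZf hZ6 hψ hχ
  exact hodgeConjectureFor_prod_prod_of_weilGenerated_of_splitSixfolds_of_floccariFu h5 hd hY.1 hZ hψ hχ' hT hG
    (fun E₀ ψ₀ hE hψ₀ hW ↦ h₃ d Y E₀ ψ ψ₀ hY.1 hE hψ hψ₀ hW)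

/-- **By name: the `Y₄/M × Z₃²` carrier cell from `(S+G)_T`, `W₆` (stmt-HodgeConjecture-2524) and Floccari–Fu** —
the general fourfold fact F1 of part 1 replaced by the REFEREED Floccari–Fu theorem. KIND of `HC_CM`: ABSENT.
[cite: FloccariFu2026, Theorem 1.2] [cite: Deligne1982HodgeCycles, §4 Prop. 4.4 and §5 (c)]
[cite: Schoen1998HodgeWeilAddendum, §10] -/
theorem hodgeQuarticFieldFourfoldCMThreefoldSquaredCarrier_of_weilGenerated_of_weilSixfolds_of_floccariFu
    (hSG : ∀ (Y Z : AbelianVariety ℂ) (ψ : Y ⟶ Y) (χ : Z ⟶ Z) (d : ℕ), 0 < d → IsQuarticFieldTypeIVFourfold Y →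
      Z.dim = 3 → Z.IsSimple → IsField Z.endAlgebra → Module.finrank ℚ Z.endAlgebra = 6 →
      ψ ≫ ψ = -(d • 𝟙 Y) → χ ≫ χ = -(d • 𝟙 Z) →
      ∃ χ' : Z ⟶ Z, χ' ≫ χ' = -(d • 𝟙 Z) ∧
        IsWeilType (Y.prod (Z.prod Z))
          (AbelianVariety.prodLift (AbelianVariety.fst Y (Z.prod Z) ≫ ψ)
            (AbelianVariety.snd Y (Z.prod Z) ≫
              AbelianVariety.prodLift (AbelianVariety.fst Z Z ≫ χ') (AbelianVariety.snd Z Z ≫ χ'))) 5 d ∧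
        IsDivisorWeilGenerated (Y.prod (Z.prod Z))
          (AbelianVariety.prodLift (AbelianVariety.fst Y (Z.prod Z) ≫ ψ)
            (AbelianVariety.snd Y (Z.prod Z) ≫
              AbelianVariety.prodLift (AbelianVariety.fst Z Z ≫ χ') (AbelianVariety.snd Z Z ≫ χ'))) 5 d)
    (hW₆ : SevenfoldWeilCensus.WeilSixfolds) (h5 : FloccariFu2026_hodgeClasses_algebraic_powers_discOneWeilFourfold) :
    HodgeQuarticFieldFourfoldCMThreefoldSquaredCarrier :=
  hodgeQuarticFieldFourfoldCMThreefoldSquaredCarrier_of_weilGenerated_of_splitSixfolds_of_floccariFu hSG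
    (fun _ _ _ _ _ _ _ _ _ hW ↦ weilAlgebraicFor_three_of_weilSixfolds hW₆ hW) h5

/-- **CELL ROW — the `Y₄(3,1) × Z₃²` carrier cell from `(S+G)_T` (hypothesis), the SPLIT-SIXFOLD slice and
Floccari–Fu.** KIND of `HC_CM`: ABSENT. [cite: FloccariFu2026, Theorem 1.2]
[cite: MoonenZarhin1998WeilClasses, Criterion (4.1)] [cite: Schoen1998HodgeWeilAddendum, §10] -/
theorem hodgeQuadraticFourfold31CMThreefoldSquaredCarrier_of_weilGenerated_of_splitSixfolds_of_floccariFu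
    (hSG : ∀ (Y Z : AbelianVariety ℂ) (ψ : Y ⟶ Y) (χ : Z ⟶ Z) (d : ℕ), 0 < d →
      Y.dim = 4 → Y.IsSimple → Module.finrank ℚ Y.endAlgebra = 2 →
      Z.dim = 3 → Z.IsSimple → IsField Z.endAlgebra → Module.finrank ℚ Z.endAlgebra = 6 →
      ψ ≫ ψ = -(d • 𝟙 Y) → χ ≫ χ = -(d • 𝟙 Z) →
      (eigenMultiplicity Y ψ (Complex.I * (Real.sqrt d : ℂ)) = 1 ∨
        eigenMultiplicity Y ψ (-(Complex.I * (Real.sqrt d : ℂ))) = 1) →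
      ∃ χ' : Z ⟶ Z, χ' ≫ χ' = -(d • 𝟙 Z) ∧
        IsWeilType (Y.prod (Z.prod Z))
          (AbelianVariety.prodLift (AbelianVariety.fst Y (Z.prod Z) ≫ ψ)
            (AbelianVariety.snd Y (Z.prod Z) ≫
              AbelianVariety.prodLift (AbelianVariety.fst Z Z ≫ χ') (AbelianVariety.snd Z Z ≫ χ'))) 5 d ∧
        IsDivisorWeilGenerated (Y.prod (Z.prod Z))
          (AbelianVariety.prodLift (AbelianVariety.fst Y (Z.prod Z) ≫ ψ)
            (AbelianVariety.snd Y (Z.prod Z) ≫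
              AbelianVariety.prodLift (AbelianVariety.fst Z Z ≫ χ') (AbelianVariety.snd Z Z ≫ χ'))) 5 d)
    (h₃ : ∀ (d : ℕ) (Y' E₀ : AbelianVariety ℂ) (ψ' : Y' ⟶ Y') (ψ₀ : E₀ ⟶ E₀), Y'.dim = 4 → E₀.dim = 1 →
      ψ' ≫ ψ' = -(d • 𝟙 Y') → ψ₀ ≫ ψ₀ = -(d • 𝟙 E₀) →
      IsWeilType (Y'.prod (E₀.prod E₀))
        (AbelianVariety.prodLift (AbelianVariety.fst Y' (E₀.prod E₀) ≫ ψ')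
          (AbelianVariety.snd Y' (E₀.prod E₀) ≫
            AbelianVariety.prodLift (AbelianVariety.fst E₀ E₀ ≫ ψ₀) (AbelianVariety.snd E₀ E₀ ≫ ψ₀))) 3 d →
      WeilAlgebraicFor 3 d (Y'.prod (E₀.prod E₀))
        (AbelianVariety.prodLift (AbelianVariety.fst Y' (E₀.prod E₀) ≫ ψ')
          (AbelianVariety.snd Y' (E₀.prod E₀) ≫
            AbelianVariety.prodLift (AbelianVariety.fst E₀ E₀ ≫ ψ₀) (AbelianVariety.snd E₀ E₀ ≫ ψ₀))))
    (h5 : FloccariFu2026_hodgeClasses_algebraic_powers_discOneWeilFourfold) :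
    HodgeQuadraticFourfold31CMThreefoldSquaredCarrier := by
  intro Y Z ψ χ d hd hY hYs hY2 hZ hZs hZf hZ6 hψ hχ hsig
  obtain ⟨χ', hχ', hT, hG⟩ := hSG Y Z ψ χ d hd hY hYs hY2 hZ hZs hZf hZ6 hψ hχ hsig
  exact hodgeConjectureFor_prod_prod_of_weilGenerated_of_splitSixfolds_of_floccariFu h5 hd hY hZ hψ hχ' hT hG
    (fun E₀ ψ₀ hE hψ₀ hW ↦ h₃ d Y E₀ ψ ψ₀ hY hE hψ hψ₀ hW)

/-- **By name: the `Y₄(3,1) × Z₃²` carrier cell from `(S+G)_T`, `W₆` (stmt-HodgeConjecture-2524) and Floccari–Fu.**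
KIND of `HC_CM`: ABSENT. [cite: FloccariFu2026, Theorem 1.2] [cite: Deligne1982HodgeCycles, §4 Prop. 4.4 and §5 (c)]
[cite: Schoen1998HodgeWeilAddendum, §10] -/
theorem hodgeQuadraticFourfold31CMThreefoldSquaredCarrier_of_weilGenerated_of_weilSixfolds_of_floccariFu
    (hSG : ∀ (Y Z : AbelianVariety ℂ) (ψ : Y ⟶ Y) (χ : Z ⟶ Z) (d : ℕ), 0 < d →
      Y.dim = 4 → Y.IsSimple → Module.finrank ℚ Y.endAlgebra = 2 →
      Z.dim = 3 → Z.IsSimple → IsField Z.endAlgebra → Module.finrank ℚ Z.endAlgebra = 6 →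
      ψ ≫ ψ = -(d • 𝟙 Y) → χ ≫ χ = -(d • 𝟙 Z) →
      (eigenMultiplicity Y ψ (Complex.I * (Real.sqrt d : ℂ)) = 1 ∨
        eigenMultiplicity Y ψ (-(Complex.I * (Real.sqrt d : ℂ))) = 1) →
      ∃ χ' : Z ⟶ Z, χ' ≫ χ' = -(d • 𝟙 Z) ∧
        IsWeilType (Y.prod (Z.prod Z))
          (AbelianVariety.prodLift (AbelianVariety.fst Y (Z.prod Z) ≫ ψ)
            (AbelianVariety.snd Y (Z.prod Z) ≫
              AbelianVariety.prodLift (AbelianVariety.fst Z Z ≫ χ') (AbelianVariety.snd Z Z ≫ χ'))) 5 d ∧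
        IsDivisorWeilGenerated (Y.prod (Z.prod Z))
          (AbelianVariety.prodLift (AbelianVariety.fst Y (Z.prod Z) ≫ ψ)
            (AbelianVariety.snd Y (Z.prod Z) ≫
              AbelianVariety.prodLift (AbelianVariety.fst Z Z ≫ χ') (AbelianVariety.snd Z Z ≫ χ'))) 5 d)
    (hW₆ : SevenfoldWeilCensus.WeilSixfolds) (h5 : FloccariFu2026_hodgeClasses_algebraic_powers_discOneWeilFourfold) :
    HodgeQuadraticFourfold31CMThreefoldSquaredCarrier :=
  hodgeQuadraticFourfold31CMThreefoldSquaredCarrier_of_weilGenerated_of_splitSixfolds_of_floccariFu hSG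
    (fun _ _ _ _ _ _ _ _ _ hW ↦ weilAlgebraicFor_three_of_weilSixfolds hW₆ hW) h5

end Summit.HodgeConjecture.HodgeConjecture.Ring2.Atlas
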